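import Summits.CriticalPhenomena.PercolationContinuityZ3.Theorems.PercAnnulusCrossingIICCondFatZd
import Summits.CriticalPhenomena.PercolationContinuityZ3.Theorems.PercAnnulusCrossingIICMassDimension
import Summits.CriticalPhenomena.PercolationContinuityZ3.Theorems.PercAnnulusCrossingIICVolumeExponentExists
import Summits.CriticalPhenomena.PercolationContinuityZ3.Theorems.PercAnnulusCrossingIICVolumePolylogEnvelope
import HarnessLib

/-!
# The lower mass dimension of Kesten's IIC in `ℤ^d` is `d − ρ⁺` under (A2)□ + CU⁺ + UAD (lane RSW3, p1 gen 17)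

builds on p205010 (kernel theorem, internal audit signed; external expert review pending) — NOT used in this file.

RSW3 lane (LANE 3 `prim-rsw3`), seat `prim-rsw3-p1` (gen 17).  Helper file (`--supports stmt-CriticalPhenomena-4575`); no definitions, no
sorries.  Memo `run/shared/lean/prim/rsw3/P1-QM.md` §30.  The `ℤ^d` analogue of gen 16's planar theorems (7)–(8): from the conditional
power-law lower tail `ν(V_n ≤ ε(2n+1)^dπ(n)) ≤ Cε^c` of `…IICCondFatZd` (hypotheses: (A2)□ at aspect `(s,L)`, robust conditional
annulus-uniqueness `CU⁺_l(c_U)`, uniform annulus decay `UAD`, all at `p_c(ℤ^d)`, `d ≥ 2`), Borel–Cantelli along `n = 2^m` gives the a.s. LOWER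
ENVELOPE `n^d π(n) ≤ n^δ V_n` eventually, for every `δ > 0`; with gen 15's upper envelope (`β⁻ + ρ⁺ ≤ d`, (A2)□ alone) this pins the
deterministic lower volume exponent of gen 14: **`β⁻ + ρ⁺ = d`**, and `β⁻ + 1/ρ = d` whenever the one-arm exponent `1/ρ` exists.

* `iicMeasure_ae_eventually_volume_ge_rpow_Zd` — the a.s. lower envelope;
* `ofReal_natCast_le_add_log_of_volume_ge_rpow` — bookkeeping `n^dπ ≤ n^δV ⇒ d − 2δ ≤ log V/log(n+2) + (−log π)/log(n+2)`;
* **`iicMeasure_lower_mass_dimension_Zd`** — `β⁻ + ρ⁺ = d` (and `β⁺ + ρ⁻ ≤ d`, `β⁻ + 1/ρ = d` if the arm exponent exists), a.s. constancy from gen 14/15;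
* `iicMeasure_lower_mass_dimension_Z3` — named for `ℤ³`;
* `iicMeasure_ae_eventually_volume_ge_div_log_pow_Zd` — the POLYLOGARITHMIC a.s. lower envelope `n^dπ(n) ≤ A(1+log n)^C V_n` (the `Cε^c` tail
  summed along `n = 2^m` with `ε_m = (m+1)^{−2/c}`), as gen 16 did on `ℤ²`.
References: H. Kesten, PTRF 73 (1986) Thm. (8); D. Basu, A. Sapozhnikov, ECP 22 (2017) Thm. 1.1; H.-O. Georgii, *Gibbs measures* (2011) Prop. 7.9.
-/

noncomputable section

namespace Summit.CriticalPhenomena.PercolationContinuityZ3.Theorems.Crossing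

open MeasureTheory Filter Topology Literature.Probability.Percolation Literature.Probability.LatticeModels
open Literature.Probability.Percolation.DCT16
open Summit.CriticalPhenomena.PercolationContinuityZ3.Theorems.SurfaceTension
open scoped ENNReal NNReal

variable {d : ℕ}

open Classical in
/-- **A.S. LOWER VOLUME ENVELOPE OF KESTEN'S IIC IN `ℤ^d`** (`d ≥ 2`; (A2)□(s,L,ϰ), `CU⁺_l(c_U)`, `UAD` at `p_c(ℤ^d)`): for every probability
measure `ν` with Kesten's IIC limit property and every `δ > 0`, `ν`-a.s. eventually **`n^d π_{p_c}(n) ≤ n^δ · #{z ∈ Λ(n) : 0 ↔ z}`**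
(Borel–Cantelli on the power-law lower tail along `n = 2^m`, then monotonicity of `V_n` and of `π`). [cite: Kesten1986, Thm. (8)] -/
theorem iicMeasure_ae_eventually_volume_ge_rpow_Zd (hd : 2 ≤ d) {s L : ℕ} (hs : 2 ≤ s) (hsL : s ≤ L) {ϰ : ℝ} (hϰ : 0 < ϰ)
    (hA2 : SetToSetQuasiMultAspectAt d (criticalProbI d) s L ϰ) {l : ℕ} (hl : 2 ≤ l) {cU : ℝ} (hcU : 0 < cU)
    (hCU : ∀ a : ℕ, 1 ≤ a → ∀ E : Set (BondConfig (Site d)), IsUpperSet E → MeasurableSet E →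
      cU * (bondPercolation (zdGraph d) (criticalProbI d)).real E ≤ (bondPercolation (zdGraph d) (criticalProbI d)).real (E ∩
        {ω : BondConfig (Site d) | ∀ t ∈ innerBoundary (zdGraph d) (box d a), ∀ s ∈ innerBoundary (zdGraph d) (box d (l * a)),
          ∀ t' ∈ innerBoundary (zdGraph d) (box d a), ∀ s' ∈ innerBoundary (zdGraph d) (box d (l * a)),
          ω ∈ openConnIn (↑((box d (l * a) \ box d a) ∪ innerBoundary (zdGraph d) (box d a)) : Set (Site d)) t s →
          ω ∈ openConnIn (↑((box d (l * a) \ box d a) ∪ innerBoundary (zdGraph d) (box d a)) : Set (Site d)) t' s' →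
          ω ∈ openConnIn (↑((box d (l * a) \ box d a) ∪ innerBoundary (zdGraph d) (box d a)) : Set (Site d)) s s'}))
    (hUAD : ∀ ε : ℝ, 0 < ε → ∃ K₀ : ℕ, ∀ m : ℕ, 1 ≤ m → ∀ N : ℕ, K₀ * m ≤ N →
      (bondPercolation (zdGraph d) (criticalProbI d)).real (boxCrossing d m N) ≤ ε)
    {ν : Measure (BondConfig (Site d))} [IsProbabilityMeasure ν]
    (hν : ∀ (F : Finset (Sym2 (Site d))) (E : Set (BondConfig (Site d))), MeasurableSet E → DeterminedBy E ↑F →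
      Tendsto (fun n : ℕ => (bondPercolation (zdGraph d) (criticalProbI d)).real (E ∩ siteToBoundary d n) /
        oneArmProb d (criticalProbI d) n) atTop (𝓝 (ν.real E)))
    {δ : ℝ} (hδ : 0 < δ) :
    ∀ᵐ ω ∂ν, ∀ᶠ n : ℕ in atTop, ((n : ℝ) ^ d * oneArmProb d (criticalProbI d) n) ≤
      (n : ℝ) ^ δ * ((((box d n).filter fun z => ω ∈ (openConn (0 : Site d) z : Set (BondConfig (Site d)))).card : ℕ) : ℝ) := by
  classical
  obtain ⟨C, c, hC, hc, htail⟩ := iicMeasure_real_volume_le_le_rpow_Zd hd hs hsL hϰ hA2 hl hcU hCU hUAD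
  -- the ratio `r = 2^{-δ}` and the dyadic failure events
  obtain ⟨r, hr⟩ : ∃ r : ℝ, r = (2 : ℝ) ^ (-δ) := ⟨_, rfl⟩
  have hr0 : 0 < r := by rw [hr]; positivity
  have hr1 : r < 1 := by rw [hr]; exact Real.rpow_lt_one_of_one_lt_of_neg (by norm_num) (by linarith)
  have hrpow : ∀ m : ℕ, r ^ m * ((2 : ℝ) ^ m) ^ δ = 1 := by
    intro m
    rw [hr, ← Real.rpow_natCast ((2 : ℝ) ^ (-δ)) m, ← Real.rpow_mul (by norm_num), ← Real.rpow_natCast (2 : ℝ) m,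
      ← Real.rpow_mul (by norm_num), ← Real.rpow_add (by norm_num)]
    ring_nf
    exact Real.rpow_zero 2
  set D : ℕ → Set (BondConfig (Site d)) := fun m =>
    {ω | ((((box d (2 ^ m)).filter fun z => ω ∈ (openConn (0 : Site d) z : Set (BondConfig (Site d)))).card : ℕ) : ℝ) ≤
      r ^ m * (2 * ((2 ^ m : ℕ) : ℝ) + 1) ^ d * oneArmProb d (criticalProbI d) (2 ^ m)} with hD
  have hBC : ∀ᵐ ω ∂ν, ∀ᶠ m in atTop, ω ∉ D m := by
    refine ae_eventually_not_mem_of_real_le ν D (fun m => C * (r ^ c) ^ m) (fun m => by positivity)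
      ((summable_geometric_of_lt_one (by positivity) (Real.rpow_lt_one hr0.le hr1 hc)).mul_left C) fun m => ?_
    have h := htail ν hν (2 ^ m) Nat.one_le_two_pow (r ^ m) (pow_pos hr0 m)
    have hrm : (r ^ m) ^ c = (r ^ c) ^ m := by
      rw [← Real.rpow_natCast r m, ← Real.rpow_mul hr0.le, mul_comm, Real.rpow_mul hr0.le, Real.rpow_natCast]
    rw [hrm] at h
    exact h
  filter_upwards [hBC] with ω hω
  obtain ⟨m₀, hm₀⟩ := hω.exists_forall_of_atTop
  refine (eventually_ge_atTop (2 ^ m₀)).mono fun n hn => ?_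
  have hn1 : 1 ≤ n := le_trans Nat.one_le_two_pow hn
  have hn0 : (0 : ℝ) < n := by exact_mod_cast hn1
  -- the dyadic scale `2^m ≤ n < 2^{m+1}` with `m ≥ m₀`
  obtain ⟨m, hm⟩ : ∃ m : ℕ, m = Nat.log 2 n := ⟨_, rfl⟩
  have hm₀m : m₀ ≤ m := by rw [hm]; exact Nat.le_log_of_pow_le (by norm_num) hn
  have h2m : 2 ^ m ≤ n := by rw [hm]; exact Nat.pow_log_le_self 2 (by omega)
  have hn2 : n < 2 ^ (m + 1) := by rw [hm]; exact Nat.lt_pow_succ_log_self (by norm_num) n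
  have hgood := hm₀ m hm₀m
  simp only [hD, Set.mem_setOf_eq, not_le] at hgood
  -- compare the scales
  have hV := card_filter_openConn_mono (d := d) h2m ω
  have hV' : ((((box d (2 ^ m)).filter fun z => ω ∈ (openConn (0 : Site d) z : Set (BondConfig (Site d)))).card : ℕ) : ℝ) ≤
      ((((box d n).filter fun z => ω ∈ (openConn (0 : Site d) z : Set (BondConfig (Site d)))).card : ℕ) : ℝ) := by exact_mod_cast hV
  have hπ : oneArmProb d (criticalProbI d) n ≤ oneArmProb d (criticalProbI d) (2 ^ m) := DCT16.real_siteToBoundary_antitone _ h2m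
  have hπ0 : 0 ≤ oneArmProb d (criticalProbI d) n := measureReal_nonneg
  have hsq : (n : ℝ) ^ d ≤ (2 * ((2 ^ m : ℕ) : ℝ) + 1) ^ d := by
    have : (n : ℝ) ≤ 2 * ((2 ^ m : ℕ) : ℝ) + 1 := by
      have h' : ((n : ℕ) : ℝ) < ((2 ^ (m + 1) : ℕ) : ℝ) := by exact_mod_cast hn2
      push_cast at h' ⊢; rw [pow_succ] at h'; linarith
    exact pow_le_pow_left₀ hn0.le this d
  have hnδ : 1 ≤ r ^ m * (n : ℝ) ^ δ := by
    rw [← hrpow m]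
    refine mul_le_mul_of_nonneg_left (Real.rpow_le_rpow (by positivity) (by exact_mod_cast h2m) hδ.le) (pow_nonneg hr0.le m)
  -- assemble
  calc (n : ℝ) ^ d * oneArmProb d (criticalProbI d) n
      ≤ (r ^ m * (n : ℝ) ^ δ) * ((2 * ((2 ^ m : ℕ) : ℝ) + 1) ^ d * oneArmProb d (criticalProbI d) (2 ^ m)) := by
        rw [← one_mul ((n : ℝ) ^ d * _)]
        exact mul_le_mul hnδ (mul_le_mul hsq hπ hπ0 (by positivity)) (mul_nonneg (by positivity) hπ0) (le_trans zero_le_one hnδ)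
    _ = (n : ℝ) ^ δ * (r ^ m * (2 * ((2 ^ m : ℕ) : ℝ) + 1) ^ d * oneArmProb d (criticalProbI d) (2 ^ m)) := by ring
    _ ≤ (n : ℝ) ^ δ * ((((box d n).filter fun z => ω ∈ (openConn (0 : Site d) z : Set (BondConfig (Site d)))).card : ℕ) : ℝ) :=
        mul_le_mul_of_nonneg_left (hgood.le.trans hV') (Real.rpow_nonneg hn0.le δ)

/-- Pointwise bookkeeping: from `n^k π ≤ n^δ V` (`V ≥ 1`, `n ≥ 2`, `0 < π ≤ 1`, `0 ≤ δ`, `k ≤ δ·log(n+2)`):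
`ofReal (k − 2δ) ≤ ofReal (log V / log(n+2)) + ofReal (−log π / log(n+2))`. [folklore] -/
theorem ofReal_natCast_le_add_log_of_volume_ge_rpow {V n k : ℕ} {δ π : ℝ} (hδ : 0 ≤ δ) (hV : 1 ≤ V) (hn : 2 ≤ n) (hπ0 : 0 < π)
    (hπ1 : π ≤ 1) (hlog : (k : ℝ) ≤ δ * Real.log ((n : ℝ) + 2)) (h : (n : ℝ) ^ k * π ≤ (n : ℝ) ^ δ * (V : ℝ)) :
    ENNReal.ofReal ((k : ℝ) - 2 * δ) ≤
      ENNReal.ofReal (Real.log (V : ℝ) / Real.log ((n : ℝ) + 2)) + ENNReal.ofReal (-Real.log π / Real.log ((n : ℝ) + 2)) := by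
  have hn0 : (0 : ℝ) < n := by exact_mod_cast (by omega : 0 < n)
  have hV0 : (0 : ℝ) < V := by exact_mod_cast (by omega : 0 < V)
  have hlog2 : 0 < Real.log ((n : ℝ) + 2) := Real.log_pos (by linarith)
  have hlogV : 0 ≤ Real.log (V : ℝ) := Real.log_nonneg (by exact_mod_cast hV)
  have hlogπ : 0 ≤ -Real.log π := by rw [neg_nonneg]; exact Real.log_nonpos hπ0.le hπ1
  have hk0 : (0 : ℝ) ≤ k := Nat.cast_nonneg k
  -- logarithms: `k log n + log π ≤ δ log n + log V`
  have hlogs : (k : ℝ) * Real.log n + Real.log π ≤ δ * Real.log n + Real.log V := by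
    have h1 := Real.log_le_log (by positivity) h
    rw [Real.log_mul (by positivity) hπ0.ne', Real.log_mul (by positivity) hV0.ne', Real.log_pow, Real.log_rpow hn0] at h1
    exact h1
  -- `log n ≥ log(n+2) − 1`
  have hlogn : Real.log ((n : ℝ) + 2) - 1 ≤ Real.log n := by
    have hq : Real.log ((n : ℝ) + 2) - Real.log n = Real.log (((n : ℝ) + 2) / n) := (Real.log_div (by positivity) (by positivity)).symm
    have hq2 : Real.log (((n : ℝ) + 2) / n) ≤ ((n : ℝ) + 2) / n - 1 := Real.log_le_sub_one_of_pos (by positivity)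
    have hq3 : ((n : ℝ) + 2) / n - 1 ≤ 1 := by
      rw [div_sub_one (by positivity), div_le_one (by positivity)]
      have : (2 : ℝ) ≤ n := by exact_mod_cast hn
      linarith
    linarith
  have hlogn' : Real.log (n : ℝ) ≤ Real.log ((n : ℝ) + 2) := Real.log_le_log hn0 (by linarith)
  rw [← ENNReal.ofReal_add (div_nonneg hlogV hlog2.le) (div_nonneg hlogπ hlog2.le)]
  refine ENNReal.ofReal_le_ofReal ?_
  rw [← add_div, le_div_iff₀ hlog2]
  by_cases hδk : δ ≤ k
  · have h1 : ((k : ℝ) - δ) * (Real.log ((n : ℝ) + 2) - 1) ≤ ((k : ℝ) - δ) * Real.log n :=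
      mul_le_mul_of_nonneg_left hlogn (by linarith)
    nlinarith
  · have hδk' := lt_of_not_ge hδk
    have : ((k : ℝ) - 2 * δ) * Real.log ((n : ℝ) + 2) ≤ 0 := mul_nonpos_of_nonpos_of_nonneg (by linarith) hlog2.le
    linarith

open Classical in
/-- **THE LOWER MASS DIMENSION OF KESTEN'S IIC IN `ℤ^d` IS `d − ρ⁺`** (`d ≥ 2`; (A2)□ at aspect `(s,L)`, `CU⁺_l(c_U)`, `UAD` at `p_c(ℤ^d)`): for
every probability measure `ν` with Kesten's IIC limit property, the deterministic volume exponents `β⁻ ≤ β⁺` of `V_n = #{z ∈ Λ(n) : 0 ↔ z}`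
(a.s. `liminf / limsup` of `log V_n / log(n+2)`, gen 14) and the one-arm exponents `ρ⁺ = limsup (−log π_{p_c}(n))/log(n+2)`, `ρ⁻ = liminf`
satisfy **`β⁻ + ρ⁺ = d`** and `β⁺ + ρ⁻ ≤ d`; and **if the arm exponent exists (`(−log π(n))/log(n+2) → 1/ρ`) then `β⁻ + 1/ρ = d`.**
(`≤` is gen 15's upper envelope under (A2)□ alone; `≥` is the a.s. lower envelope of this file.)
[cite: Kesten1986, Thm. (8)] [cite: BasuSapozhnikov2017ECP, Thm. 1.1] [cite: Georgii2011, Prop. 7.9] -/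
theorem iicMeasure_lower_mass_dimension_Zd (hd : 2 ≤ d) {s L : ℕ} (hs : 2 ≤ s) (hsL : s ≤ L) {ϰ : ℝ} (hϰ : 0 < ϰ)
    (hA2 : SetToSetQuasiMultAspectAt d (criticalProbI d) s L ϰ) {l : ℕ} (hl : 2 ≤ l) {cU : ℝ} (hcU : 0 < cU)
    (hCU : ∀ a : ℕ, 1 ≤ a → ∀ E : Set (BondConfig (Site d)), IsUpperSet E → MeasurableSet E →
      cU * (bondPercolation (zdGraph d) (criticalProbI d)).real E ≤ (bondPercolation (zdGraph d) (criticalProbI d)).real (E ∩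
        {ω : BondConfig (Site d) | ∀ t ∈ innerBoundary (zdGraph d) (box d a), ∀ s ∈ innerBoundary (zdGraph d) (box d (l * a)),
          ∀ t' ∈ innerBoundary (zdGraph d) (box d a), ∀ s' ∈ innerBoundary (zdGraph d) (box d (l * a)),
          ω ∈ openConnIn (↑((box d (l * a) \ box d a) ∪ innerBoundary (zdGraph d) (box d a)) : Set (Site d)) t s →
          ω ∈ openConnIn (↑((box d (l * a) \ box d a) ∪ innerBoundary (zdGraph d) (box d a)) : Set (Site d)) t' s' →
          ω ∈ openConnIn (↑((box d (l * a) \ box d a) ∪ innerBoundary (zdGraph d) (box d a)) : Set (Site d)) s s'}))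
    (hUAD : ∀ ε : ℝ, 0 < ε → ∃ K₀ : ℕ, ∀ m : ℕ, 1 ≤ m → ∀ N : ℕ, K₀ * m ≤ N →
      (bondPercolation (zdGraph d) (criticalProbI d)).real (boxCrossing d m N) ≤ ε)
    {ν : Measure (BondConfig (Site d))} [IsProbabilityMeasure ν]
    (hν : ∀ (F : Finset (Sym2 (Site d))) (E : Set (BondConfig (Site d))), MeasurableSet E → DeterminedBy E ↑F →
      Tendsto (fun n : ℕ => (bondPercolation (zdGraph d) (criticalProbI d)).real (E ∩ siteToBoundary d n) /
        oneArmProb d (criticalProbI d) n) atTop (𝓝 (ν.real E))) :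
    ∃ βl βu : ℝ≥0∞, (βl ≤ βu ∧ βu ≤ d ∧
      βl + limsup (fun n : ℕ => ENNReal.ofReal (-Real.log (oneArmProb d (criticalProbI d) n) / Real.log ((n : ℝ) + 2))) atTop = d ∧
      βu + liminf (fun n : ℕ => ENNReal.ofReal (-Real.log (oneArmProb d (criticalProbI d) n) / Real.log ((n : ℝ) + 2))) atTop ≤ d ∧
      (∀ ρinv : ℝ≥0∞, Tendsto (fun n : ℕ => ENNReal.ofReal (-Real.log (oneArmProb d (criticalProbI d) n) / Real.log ((n : ℝ) + 2)))
        atTop (𝓝 ρinv) → βl + ρinv = d)) ∧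
      ∀ᵐ ω ∂ν,
      liminf (fun n => ENNReal.ofReal
        (Real.log ((((box d n).filter fun z => ω ∈ (openConn (0 : Site d) z : Set (BondConfig (Site d)))).card : ℕ) : ℝ) /
          Real.log ((n : ℝ) + 2))) atTop = βl ∧
      limsup (fun n => ENNReal.ofReal
        (Real.log ((((box d n).filter fun z => ω ∈ (openConn (0 : Site d) z : Set (BondConfig (Site d)))).card : ℕ) : ℝ) /
          Real.log ((n : ℝ) + 2))) atTop = βu := by
  classical
  have hd1 : 1 ≤ d := le_trans (by norm_num) hd
  have hpc0 : 0 < ((criticalProbI d : unitInterval) : ℝ) := by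
    rw [coe_criticalProbI]; exact criticalProb_zd_pos d hd1
  obtain ⟨βl, βu, ⟨h1, h2, h3, h4⟩, hae⟩ := iicMeasure_mass_dimension_criticalProbI hd hs hsL hϰ hA2 hν
  -- the a.s. lower envelopes for `δ = 1/(k+1)`, all `k`
  have henv : ∀ᵐ ω ∂ν, ∀ k : ℕ, ∀ᶠ n : ℕ in atTop, ((n : ℝ) ^ d * oneArmProb d (criticalProbI d) n) ≤
      (n : ℝ) ^ (1 / ((k : ℝ) + 1)) * ((((box d n).filter fun z => ω ∈ (openConn (0 : Site d) z : Set (BondConfig (Site d)))).card : ℕ) : ℝ) :=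
    ae_all_iff.2 fun k => iicMeasure_ae_eventually_volume_ge_rpow_Zd hd hs hsL hϰ hA2 hl hcU hCU hUAD hν (by positivity)
  obtain ⟨ω, hω, hωenv⟩ := (hae.and henv).exists
  obtain ⟨hβl, hβu⟩ := hω
  set x : ℕ → ℝ≥0∞ := fun n => ENNReal.ofReal
    (Real.log ((((box d n).filter fun z => ω ∈ (openConn (0 : Site d) z : Set (BondConfig (Site d)))).card : ℕ) : ℝ) /
      Real.log ((n : ℝ) + 2)) with hx
  set w : ℕ → ℝ≥0∞ := fun n => ENNReal.ofReal (-Real.log (oneArmProb d (criticalProbI d) n) / Real.log ((n : ℝ) + 2)) with hw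
  -- `d − 2/(k+1) ≤ liminf (x + w)` for every `k`
  have hlog : Tendsto (fun n : ℕ => Real.log ((n : ℝ) + 2)) atTop atTop :=
    Real.tendsto_log_atTop.comp (tendsto_atTop_add_const_right _ _ tendsto_natCast_atTop_atTop)
  have hkey : ∀ k : ℕ, ENNReal.ofReal ((d : ℝ) - 2 * (1 / ((k : ℝ) + 1))) ≤ liminf (fun n => x n + w n) atTop := by
    intro k
    have hδ : (0 : ℝ) < 1 / ((k : ℝ) + 1) := by positivity
    have hev : ∀ᶠ n : ℕ in atTop, 2 ≤ n ∧ (d : ℝ) ≤ 1 / ((k : ℝ) + 1) * Real.log ((n : ℝ) + 2) :=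
      (eventually_ge_atTop 2).and ((hlog.const_mul_atTop hδ).eventually_ge_atTop (d : ℝ))
    refine le_liminf_of_le (by isBoundedDefault) (((hωenv k).and hev).mono fun n hn => ?_)
    obtain ⟨hnenv, hn2, hnlog⟩ := hn
    exact ofReal_natCast_le_add_log_of_volume_ge_rpow hδ.le (one_le_card_filter_openConn_zero' n ω) hn2
      (oneArmProb_pos hd1 _ hpc0 n) (by unfold oneArmProb; exact measureReal_le_one) hnlog hnenv
  have hlow : (d : ℝ≥0∞) ≤ liminf (fun n => x n + w n) atTop := by
    refine ENNReal.le_of_forall_pos_le_add fun ε hε _ => ?_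
    have hε' : (0 : ℝ) < ε := NNReal.coe_pos.2 hε
    obtain ⟨k, hk⟩ := exists_nat_one_div_lt (show (0 : ℝ) < ε / 2 by linarith)
    have hsplit : (d : ℝ≥0∞) ≤ ENNReal.ofReal ((d : ℝ) - 2 * (1 / ((k : ℝ) + 1))) + ε := by
      calc (d : ℝ≥0∞) = ENNReal.ofReal (((d : ℝ) - (ε : ℝ)) + ε) := by rw [sub_add_cancel, ENNReal.ofReal_natCast]
        _ ≤ ENNReal.ofReal ((d : ℝ) - (ε : ℝ)) + ENNReal.ofReal (ε : ℝ) := ENNReal.ofReal_add_le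
        _ ≤ ENNReal.ofReal ((d : ℝ) - 2 * (1 / ((k : ℝ) + 1))) + ε := by
            rw [ENNReal.ofReal_coe_nnreal]
            exact add_le_add (ENNReal.ofReal_le_ofReal (by linarith)) le_rfl
    exact hsplit.trans (add_le_add (hkey k) le_rfl)
  -- `d ≤ βl + ρ⁺`
  have hnew : (d : ℝ≥0∞) ≤ βl + limsup w atTop := by
    rw [← hβl]
    exact hlow.trans (liminf_add_le_liminf_add_limsup x w)
  refine ⟨βl, βu, ⟨h1, h2, le_antisymm h3 hnew, h4, fun ρinv hρ => ?_⟩, hae⟩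
  have h3' := h3
  have hnew' := hnew
  rw [hρ.limsup_eq] at h3' hnew'
  exact le_antisymm h3' hnew'

open Classical in
/-- **THE LOWER MASS DIMENSION OF KESTEN'S IIC ON `ℤ³` IS `3 − ρ⁺`** (instance `d = 3`): under (A2)□ at aspect `(s,L)`, `CU⁺_l(c_U)` and `UAD`
at `p_c(ℤ³)`, for every IIC-type probability measure `ν`: `β⁻ + ρ⁺ = 3`, `β⁺ + ρ⁻ ≤ 3`, and `β⁻ + 1/ρ = 3` if the one-arm exponent exists.
NEW (conditional). [cite: Kesten1986, Thm. (8)] [cite: BasuSapozhnikov2017ECP, Thm. 1.1] -/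
theorem iicMeasure_lower_mass_dimension_Z3 {s L : ℕ} (hs : 2 ≤ s) (hsL : s ≤ L) {ϰ : ℝ} (hϰ : 0 < ϰ)
    (hA2 : SetToSetQuasiMultAspectAt 3 (criticalProbI 3) s L ϰ) {l : ℕ} (hl : 2 ≤ l) {cU : ℝ} (hcU : 0 < cU)
    (hCU : ∀ a : ℕ, 1 ≤ a → ∀ E : Set (BondConfig (Site 3)), IsUpperSet E → MeasurableSet E →
      cU * (bondPercolation (zdGraph 3) (criticalProbI 3)).real E ≤ (bondPercolation (zdGraph 3) (criticalProbI 3)).real (E ∩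
        {ω : BondConfig (Site 3) | ∀ t ∈ innerBoundary (zdGraph 3) (box 3 a), ∀ s ∈ innerBoundary (zdGraph 3) (box 3 (l * a)),
          ∀ t' ∈ innerBoundary (zdGraph 3) (box 3 a), ∀ s' ∈ innerBoundary (zdGraph 3) (box 3 (l * a)),
          ω ∈ openConnIn (↑((box 3 (l * a) \ box 3 a) ∪ innerBoundary (zdGraph 3) (box 3 a)) : Set (Site 3)) t s →
          ω ∈ openConnIn (↑((box 3 (l * a) \ box 3 a) ∪ innerBoundary (zdGraph 3) (box 3 a)) : Set (Site 3)) t' s' →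
          ω ∈ openConnIn (↑((box 3 (l * a) \ box 3 a) ∪ innerBoundary (zdGraph 3) (box 3 a)) : Set (Site 3)) s s'}))
    (hUAD : ∀ ε : ℝ, 0 < ε → ∃ K₀ : ℕ, ∀ m : ℕ, 1 ≤ m → ∀ N : ℕ, K₀ * m ≤ N →
      (bondPercolation (zdGraph 3) (criticalProbI 3)).real (boxCrossing 3 m N) ≤ ε)
    {ν : Measure (BondConfig (Site 3))} [IsProbabilityMeasure ν]
    (hν : ∀ (F : Finset (Sym2 (Site 3))) (E : Set (BondConfig (Site 3))), MeasurableSet E → DeterminedBy E ↑F →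
      Tendsto (fun n : ℕ => (bondPercolation (zdGraph 3) (criticalProbI 3)).real (E ∩ siteToBoundary 3 n) /
        oneArmProb 3 (criticalProbI 3) n) atTop (𝓝 (ν.real E))) :
    ∃ βl βu : ℝ≥0∞, (βl ≤ βu ∧ βu ≤ 3 ∧
      βl + limsup (fun n : ℕ => ENNReal.ofReal (-Real.log (oneArmProb 3 (criticalProbI 3) n) / Real.log ((n : ℝ) + 2))) atTop = 3 ∧
      βu + liminf (fun n : ℕ => ENNReal.ofReal (-Real.log (oneArmProb 3 (criticalProbI 3) n) / Real.log ((n : ℝ) + 2))) atTop ≤ 3 ∧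
      (∀ ρinv : ℝ≥0∞, Tendsto (fun n : ℕ => ENNReal.ofReal (-Real.log (oneArmProb 3 (criticalProbI 3) n) / Real.log ((n : ℝ) + 2)))
        atTop (𝓝 ρinv) → βl + ρinv = 3)) ∧
      ∀ᵐ ω ∂ν,
      liminf (fun n => ENNReal.ofReal
        (Real.log ((((box 3 n).filter fun z => ω ∈ (openConn (0 : Site 3) z : Set (BondConfig (Site 3)))).card : ℕ) : ℝ) /
          Real.log ((n : ℝ) + 2))) atTop = βl ∧
      limsup (fun n => ENNReal.ofReal
        (Real.log ((((box 3 n).filter fun z => ω ∈ (openConn (0 : Site 3) z : Set (BondConfig (Site 3)))).card : ℕ) : ℝ) /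
          Real.log ((n : ℝ) + 2))) atTop = βu := by
  have h := iicMeasure_lower_mass_dimension_Zd (d := 3) (by norm_num) hs hsL hϰ hA2 hl hcU hCU hUAD hν
  push_cast at h ⊢
  exact h

open Classical in
/-- **A.S. POLYLOGARITHMIC LOWER ENVELOPE `n^d π_{p_c}(n) ≤ A(1 + log n)^C V_n` IN `ℤ^d`** (`d ≥ 2`; (A2)□(s,L,ϰ), `CU⁺_l(c_U)`, `UAD` at
`p_c(ℤ^d)`): there are `A, C > 0` such that for every IIC-type probability measure `ν`, `ν`-a.s. eventually
`n^dπ(n) ≤ A(1 + log n)^C · #{z ∈ Λ(n) : 0 ↔ z}` (Borel–Cantelli on the `Cε^c` lower tail along `n = 2^m` with `ε_m = (m+1)^{−2/c}`).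
[cite: Kesten1986, Thm. (8)] -/
theorem iicMeasure_ae_eventually_volume_ge_div_log_pow_Zd (hd : 2 ≤ d) {s L : ℕ} (hs : 2 ≤ s) (hsL : s ≤ L) {ϰ : ℝ} (hϰ : 0 < ϰ)
    (hA2 : SetToSetQuasiMultAspectAt d (criticalProbI d) s L ϰ) {l : ℕ} (hl : 2 ≤ l) {cU : ℝ} (hcU : 0 < cU)
    (hCU : ∀ a : ℕ, 1 ≤ a → ∀ E : Set (BondConfig (Site d)), IsUpperSet E → MeasurableSet E →
      cU * (bondPercolation (zdGraph d) (criticalProbI d)).real E ≤ (bondPercolation (zdGraph d) (criticalProbI d)).real (E ∩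
        {ω : BondConfig (Site d) | ∀ t ∈ innerBoundary (zdGraph d) (box d a), ∀ s ∈ innerBoundary (zdGraph d) (box d (l * a)),
          ∀ t' ∈ innerBoundary (zdGraph d) (box d a), ∀ s' ∈ innerBoundary (zdGraph d) (box d (l * a)),
          ω ∈ openConnIn (↑((box d (l * a) \ box d a) ∪ innerBoundary (zdGraph d) (box d a)) : Set (Site d)) t s →
          ω ∈ openConnIn (↑((box d (l * a) \ box d a) ∪ innerBoundary (zdGraph d) (box d a)) : Set (Site d)) t' s' →
          ω ∈ openConnIn (↑((box d (l * a) \ box d a) ∪ innerBoundary (zdGraph d) (box d a)) : Set (Site d)) s s'}))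
    (hUAD : ∀ ε : ℝ, 0 < ε → ∃ K₀ : ℕ, ∀ m : ℕ, 1 ≤ m → ∀ N : ℕ, K₀ * m ≤ N →
      (bondPercolation (zdGraph d) (criticalProbI d)).real (boxCrossing d m N) ≤ ε) :
    ∃ A C : ℝ, 0 < A ∧ 0 < C ∧ ∀ (ν : Measure (BondConfig (Site d))) [IsProbabilityMeasure ν],
      (∀ (F : Finset (Sym2 (Site d))) (E : Set (BondConfig (Site d))), MeasurableSet E → DeterminedBy E ↑F →
        Tendsto (fun n : ℕ => (bondPercolation (zdGraph d) (criticalProbI d)).real (E ∩ siteToBoundary d n) /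
          oneArmProb d (criticalProbI d) n) atTop (𝓝 (ν.real E))) →
      ∀ᵐ ω ∂ν, ∀ᶠ n : ℕ in atTop, ((n : ℝ) ^ d * oneArmProb d (criticalProbI d) n) ≤
        A * (1 + Real.log n) ^ C * ((((box d n).filter fun z => ω ∈ (openConn (0 : Site d) z : Set (BondConfig (Site d)))).card : ℕ) : ℝ) := by
  classical
  obtain ⟨C, c, hC, hc, htail⟩ := iicMeasure_real_volume_le_le_rpow_Zd hd hs hsL hϰ hA2 hl hcU hCU hUAD
  refine ⟨(2 : ℝ) ^ (2 / c), 2 / c, by positivity, by positivity, fun ν _ hν => ?_⟩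
  -- levels `ε_m = (m+1)^{-2/c}` along `n = 2^m`
  set D : ℕ → Set (BondConfig (Site d)) := fun m =>
    {ω | ((((box d (2 ^ m)).filter fun z => ω ∈ (openConn (0 : Site d) z : Set (BondConfig (Site d)))).card : ℕ) : ℝ) ≤
      ((m : ℝ) + 1) ^ (-(2 / c)) * (2 * ((2 ^ m : ℕ) : ℝ) + 1) ^ d * oneArmProb d (criticalProbI d) (2 ^ m)} with hD
  have hBC : ∀ᵐ ω ∂ν, ∀ᶠ m in atTop, ω ∉ D m := by
    refine ae_eventually_not_mem_of_real_le ν D (fun m => C / ((m : ℝ) + 1) ^ 2) (fun m => by positivity) ?_ fun m => ?_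
    · have h := (summable_nat_add_iff 1).2 ((Real.summable_one_div_nat_pow).2 one_lt_two)
      simpa [div_eq_mul_one_div C] using h.mul_left C
    · have h := htail ν hν (2 ^ m) Nat.one_le_two_pow (((m : ℝ) + 1) ^ (-(2 / c))) (by positivity)
      have hε : (((m : ℝ) + 1) ^ (-(2 / c))) ^ c = 1 / ((m : ℝ) + 1) ^ 2 := by
        rw [← Real.rpow_mul (by positivity), show -(2 / c) * c = -(2 : ℝ) by field_simp, Real.rpow_neg (by positivity),
          one_div, Real.rpow_two]
      rw [hε, ← div_eq_mul_one_div] at h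
      exact h
  filter_upwards [hBC] with ω hω
  obtain ⟨m₀, hm₀⟩ := hω.exists_forall_of_atTop
  refine (eventually_ge_atTop (2 ^ m₀)).mono fun n hn => ?_
  have hn1 : 1 ≤ n := le_trans Nat.one_le_two_pow hn
  have hn0 : (0 : ℝ) < n := by exact_mod_cast hn1
  obtain ⟨m, hm⟩ : ∃ m : ℕ, m = Nat.log 2 n := ⟨_, rfl⟩
  have hm₀m : m₀ ≤ m := by rw [hm]; exact Nat.le_log_of_pow_le (by norm_num) hn
  have h2m : 2 ^ m ≤ n := by rw [hm]; exact Nat.pow_log_le_self 2 (by omega)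
  have hn2 : n < 2 ^ (m + 1) := by rw [hm]; exact Nat.lt_pow_succ_log_self (by norm_num) n
  have hgood := hm₀ m hm₀m
  simp only [hD, Set.mem_setOf_eq, not_le] at hgood
  have hV := card_filter_openConn_mono (d := d) h2m ω
  have hV' : ((((box d (2 ^ m)).filter fun z => ω ∈ (openConn (0 : Site d) z : Set (BondConfig (Site d)))).card : ℕ) : ℝ) ≤
      ((((box d n).filter fun z => ω ∈ (openConn (0 : Site d) z : Set (BondConfig (Site d)))).card : ℕ) : ℝ) := by exact_mod_cast hV
  have hπ : oneArmProb d (criticalProbI d) n ≤ oneArmProb d (criticalProbI d) (2 ^ m) := DCT16.real_siteToBoundary_antitone _ h2m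
  have hπ0 : 0 ≤ oneArmProb d (criticalProbI d) n := measureReal_nonneg
  have hsq : (n : ℝ) ^ d ≤ (2 * ((2 ^ m : ℕ) : ℝ) + 1) ^ d := by
    have : (n : ℝ) ≤ 2 * ((2 ^ m : ℕ) : ℝ) + 1 := by
      have h' : ((n : ℕ) : ℝ) < ((2 ^ (m + 1) : ℕ) : ℝ) := by exact_mod_cast hn2
      push_cast at h' ⊢; rw [pow_succ] at h'; linarith
    exact pow_le_pow_left₀ hn0.le this d
  -- `(m+1)^{2/c} ≤ (2(1+log n))^{2/c} = 2^{2/c} (1 + log n)^{2/c}`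
  have hm1 : (m : ℝ) + 1 ≤ 2 * (1 + Real.log n) := by linarith [natLog_le_two_mul_log h2m]
  have hlogn : 0 ≤ Real.log n := Real.log_nonneg (by exact_mod_cast hn1)
  have hfac : ((m : ℝ) + 1) ^ (2 / c) ≤ (2 : ℝ) ^ (2 / c) * (1 + Real.log n) ^ (2 / c) := by
    rw [← Real.mul_rpow (by norm_num) (by positivity)]
    exact Real.rpow_le_rpow (by positivity) hm1 (by positivity)
  have hinv : ((m : ℝ) + 1) ^ (2 / c) * ((m : ℝ) + 1) ^ (-(2 / c)) = 1 := by
    rw [Real.rpow_neg (by positivity), mul_inv_cancel₀ (Real.rpow_pos_of_pos (by positivity) _).ne']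
  calc (n : ℝ) ^ d * oneArmProb d (criticalProbI d) n
      ≤ (2 * ((2 ^ m : ℕ) : ℝ) + 1) ^ d * oneArmProb d (criticalProbI d) (2 ^ m) := mul_le_mul hsq hπ hπ0 (by positivity)
    _ = ((m : ℝ) + 1) ^ (2 / c) * (((m : ℝ) + 1) ^ (-(2 / c)) * (2 * ((2 ^ m : ℕ) : ℝ) + 1) ^ d *
          oneArmProb d (criticalProbI d) (2 ^ m)) := by
        rw [← mul_assoc, ← mul_assoc, hinv, one_mul]
    _ ≤ ((m : ℝ) + 1) ^ (2 / c) * ((((box d n).filter fun z => ω ∈ (openConn (0 : Site d) z : Set (BondConfig (Site d)))).card : ℕ) : ℝ) :=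
        mul_le_mul_of_nonneg_left (hgood.le.trans hV') (by positivity)
    _ ≤ (2 : ℝ) ^ (2 / c) * (1 + Real.log n) ^ (2 / c) *
          ((((box d n).filter fun z => ω ∈ (openConn (0 : Site d) z : Set (BondConfig (Site d)))).card : ℕ) : ℝ) :=
        mul_le_mul_of_nonneg_right hfac (Nat.cast_nonneg _)

end Summit.CriticalPhenomena.PercolationContinuityZ3.Theorems.Crossing

end
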